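import Summits.Parity.BatemanHorn.Theorems.AlmostPrimeZerosDefs
import Summits.Parity.BatemanHorn.Theorems.AlmostPrimeZerosSystemLSDRealSegmentSandwich
import Summits.Parity.BatemanHorn.Theorems.IsogenyRedeiTypeIMainTermWeights
import Literature.NumberTheory.Sieve.BatemanHornProofs
import HarnessLib

/-!
# Route `AlmostPrimeZeros`, crux `SystemLSDRealSegment` (stmt-Parity-11292), line
# `beta-thinned-root-kernel`: arithmetic structure of the Type-I coefficient `b` (helper of `stub_typeILocal`)

For a family `f = (f₁,…,f_k) : Fin k → ℤ[X]` and a real `y`, the Type-I coefficient of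
`Summits/Parity/BatemanHorn/Theorems/AlmostPrimeZerosDefs.lean` is
`b(m) = bCoeff f y m = Σ_{d ∈ prodTuples k m} ∏ᵢ h_y(dᵢ) · δ_f(d)`, `δ_f(d) = tupleDens f d = c_f(d)/lcm(d)`.
We prove:

* `0 ≤ b(m)` for `y ≥ 1`, `b(1) = 1`, and **`b(mn) = b(m) b(n)` for `(m, n) = 1`**: the bookkeeping is
  that of the sibling item `TypeIMainTerm` (`prodTuples k m = Nat.finMulAntidiag k m`,
  `tupleDens f d = TypeIMainTerm.sysDensity f d` — same `lcm`, same solution count), the tuples with product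
  `mn` are the pointwise products of the tuples with products `m` and `n`
  (`TypeIMainTerm.isMultiplicative_pushforward`), `h_y` is multiplicative (`thinWeight_mul`) and `δ_f` is
  multiplicative over tuples with coprime supports by the Chinese remainder theorem
  (`TypeIMainTerm.sysDensity_mul`);
* the tuples with product `p^w` are the `(p^{vᵢ})` with `Σ vᵢ = w` (at most `(w+1)^k` of them), the tuples
  with product `p` are the `k` single-slot tuples, of density `ρᵢ(p)/p` (`ρᵢ(p) = polyRootCountMod ![fᵢ] p`);
* hence `b(p) = (y − 1) Σᵢ ρᵢ(p)/p` at EVERY prime and `b(p^ν) = 0` for `ν > 2k` (a slot `vᵢ ≥ 3` has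
  `h_y(p^{vᵢ}) = 0`), for every family and every real `y`.

References: H. Halberstam, H.-E. Richert, *Sieve Methods* (1974) §5.3; the line card
`Cruxes/SystemLSDRealSegment/Lines/beta-thinned-root-kernel.md`.
-/

open Filter Finset Polynomial
open scoped BigOperators Topology

namespace Summit.Parity.BatemanHorn.Cruxes.SystemLSDRealSegment.BetaThinnedRootKernel

open Literature.NumberTheory.Sieve
open Summit.Parity.BatemanHorn.Theorems

noncomputable section

variable {k : ℕ}

/-! ### The weights for real `y ≥ 1` -/

/-- `0 ≤ thinCoeff y v` for `y ≥ 1` (`thinCoeff y v ∈ {1, y − 1, y² − y, 0}`). [folklore] -/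
theorem thinCoeff_nonneg {y : ℝ} (hy : 1 ≤ y) (v : ℕ) : 0 ≤ thinCoeff y v := by
  rcases Nat.lt_or_ge v 3 with h | h
  · interval_cases v
    · simp
    · simp only [thinCoeff_one]; linarith
    · simp only [thinCoeff_two]; nlinarith
  · rw [thinCoeff_of_three_le y h]

/-- `thinCoeff y v ≤ y²` for `y ≥ 1`. [folklore] -/
theorem thinCoeff_le_sq {y : ℝ} (hy : 1 ≤ y) (v : ℕ) : thinCoeff y v ≤ y ^ 2 := by
  rcases Nat.lt_or_ge v 3 with h | h
  · interval_cases v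
    · simp only [thinCoeff_zero]; nlinarith
    · simp only [thinCoeff_one]; nlinarith
    · simp only [thinCoeff_two]; nlinarith
  · rw [thinCoeff_of_three_le y h]; positivity

/-- `0 ≤ h_y(d)` for `y ≥ 1`. [folklore] -/
theorem thinWeight_nonneg {y : ℝ} (hy : 1 ≤ y) (d : ℕ) : 0 ≤ thinWeight y d := by
  unfold thinWeight Finsupp.prod
  exact Finset.prod_nonneg fun p _ => thinCoeff_nonneg hy _

/-- `h_y(ab) = h_y(a) h_y(b)` for coprime `a, b` (also in the degenerate cases `a = 0` or `b = 0`, where the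
other argument is `1`). [folklore] -/
theorem thinWeight_mul_of_coprime (y : ℝ) {a b : ℕ} (h : a.Coprime b) :
    thinWeight y (a * b) = thinWeight y a * thinWeight y b := by
  rcases eq_or_ne a 0 with rfl | ha
  · rw [Nat.coprime_zero_left] at h
    subst h
    rw [mul_one, thinWeight_one, mul_one]
  rcases eq_or_ne b 0 with rfl | hb
  · rw [Nat.coprime_zero_right] at h
    subst h
    rw [one_mul, thinWeight_one, one_mul]
  exact thinWeight_mul y ha hb h

/-- The tuple weight `∏ᵢ h_y(dᵢ)` is multiplicative over tuples with coprime supports. [folklore] -/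
theorem prod_thinWeight_mul (y : ℝ) {d d' : Fin k → ℕ} (hcop : Nat.Coprime (∏ i, d i) (∏ i, d' i)) :
    ∏ i, thinWeight y ((d * d') i) = (∏ i, thinWeight y (d i)) * ∏ i, thinWeight y (d' i) := by
  rw [← Finset.prod_mul_distrib]
  refine Finset.prod_congr rfl fun i _ => ?_
  rw [Pi.mul_apply]
  exact thinWeight_mul_of_coprime y (Nat.Coprime.of_dvd (Finset.dvd_prod_of_mem d (Finset.mem_univ i))
    (Finset.dvd_prod_of_mem d' (Finset.mem_univ i)) hcop)

/-! ### The bookkeeping is the `TypeIMainTerm` bookkeeping -/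

/-- Membership in `prodTuples`. [folklore] -/
theorem mem_prodTuples_iff {m : ℕ} {d : Fin k → ℕ} :
    d ∈ prodTuples k m ↔ (∀ i, d i ∈ m.divisors) ∧ ∏ i, d i = m := by
  simp [prodTuples, Fintype.mem_piFinset]

/-- `prodTuples k m` is Mathlib's `Nat.finMulAntidiag k m` (both are empty for `m = 0`). [folklore] -/
theorem prodTuples_eq_finMulAntidiag (k m : ℕ) : prodTuples k m = Nat.finMulAntidiag k m := by
  rcases eq_or_ne m 0 with rfl | hm
  · rw [Nat.finMulAntidiag_zero_right]
    refine Finset.eq_empty_of_forall_notMem fun d hd => ?_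
    obtain ⟨hdiv, hprod⟩ := mem_prodTuples_iff.mp hd
    obtain ⟨i, -, hi⟩ := Finset.prod_eq_zero_iff.mp hprod
    simpa [hi] using hdiv i
  · rw [prodTuples, Nat.finMulAntidiag_eq_piFinset_divisors_filter (dvd_refl m) hm]

/-- `tupleDens f d = TypeIMainTerm.sysDensity f d` (same `lcm`, same count). [folklore] -/
theorem tupleDens_eq_sysDensity (f : Fin k → ℤ[X]) (d : Fin k → ℕ) :
    tupleDens f d = TypeIMainTerm.sysDensity f d := rfl

/-- `0 ≤ δ_f(d)`. [folklore] -/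
theorem tupleDens_nonneg (f : Fin k → ℤ[X]) (d : Fin k → ℕ) : 0 ≤ tupleDens f d :=
  div_nonneg (Nat.cast_nonneg _) (Nat.cast_nonneg _)

/-! ### `b ≥ 0`, `b(1) = 1`, multiplicativity -/

/-- `0 ≤ b(m)` for `y ≥ 1`. [folklore] -/
theorem bCoeff_nonneg (f : Fin k → ℤ[X]) {y : ℝ} (hy : 1 ≤ y) (m : ℕ) : 0 ≤ bCoeff f y m :=
  Finset.sum_nonneg fun d _ => mul_nonneg (prod_thinWeight_nonneg hy d) (tupleDens_nonneg f d)

/-- `b` as the pushforward `m ↦ Σ_{d ∈ finMulAntidiag k m} ∏ᵢ h_y(dᵢ) · sysDensity f d`. [folklore] -/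
theorem bCoeff_eq_sum_finMulAntidiag (f : Fin k → ℤ[X]) (y : ℝ) (m : ℕ) :
    bCoeff f y m = ∑ d ∈ Nat.finMulAntidiag k m, (∏ i, thinWeight y (d i)) * TypeIMainTerm.sysDensity f d := by
  rw [bCoeff, prodTuples_eq_finMulAntidiag]
  rfl

/-- The pushforward `m ↦ Σ_{∏ dᵢ = m} ∏ᵢ h_y(dᵢ) δ_f(d)` is a multiplicative arithmetic function
(tuple-multiplicativity of the weight: `thinWeight_mul` and the CRT `TypeIMainTerm.sysDensity_mul`). [folklore] -/
theorem isMultiplicative_bCoeff (f : Fin k → ℤ[X]) (y : ℝ) :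
    ArithmeticFunction.IsMultiplicative
      (⟨fun m => ∑ d ∈ Nat.finMulAntidiag k m, (∏ i, thinWeight y (d i)) * TypeIMainTerm.sysDensity f d,
        by simp⟩ : ArithmeticFunction ℝ) := by
  refine TypeIMainTerm.isMultiplicative_pushforward
    (fun d => (∏ i, thinWeight y (d i)) * TypeIMainTerm.sysDensity f d) ?_ ?_
  · simp only [thinWeight_one, Finset.prod_const_one, one_mul]
    exact TypeIMainTerm.sysDensity_one f
  · intro d d' hcop
    rw [prod_thinWeight_mul y hcop, TypeIMainTerm.sysDensity_mul f hcop]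
    ring

/-- `b(1) = 1`. [folklore] -/
theorem bCoeff_one (f : Fin k → ℤ[X]) (y : ℝ) : bCoeff f y 1 = 1 := by
  rw [bCoeff_eq_sum_finMulAntidiag]
  exact (isMultiplicative_bCoeff f y).map_one

/-- **`b` is multiplicative on coprime arguments** (CRT). [folklore] -/
theorem bCoeff_mul_of_coprime (f : Fin k → ℤ[X]) (y : ℝ) {m n : ℕ} (h : m.Coprime n) :
    bCoeff f y (m * n) = bCoeff f y m * bCoeff f y n := by
  simp only [bCoeff_eq_sum_finMulAntidiag]
  exact (isMultiplicative_bCoeff f y).map_mul_of_coprime h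

/-! ### Tuples with prime-power product -/

-- The next three lemmas are adapted from the sibling item's
-- `Summits/Parity/BatemanHorn/Theorems/IsogenyRedeiTypeIMainTermExactIdentity.lean` (stated for `prodTuples`).

/-- A tuple with product `p^w` consists of powers `p^{vᵢ}`, `vᵢ ≤ w`, `Σ vᵢ = w`. [folklore] -/
theorem exists_pow_eq_of_mem_prodTuples {p : ℕ} (hp : p.Prime) {w : ℕ} {d : Fin k → ℕ}
    (hd : d ∈ prodTuples k (p ^ w)) :
    ∃ v : Fin k → ℕ, (∀ i, d i = p ^ v i) ∧ (∀ i, v i ≤ w) ∧ ∑ i, v i = w := by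
  rw [prodTuples_eq_finMulAntidiag] at hd
  have h : ∀ i, ∃ v ≤ w, d i = p ^ v := fun i =>
    (Nat.dvd_prime_pow hp).mp (Nat.dvd_of_mem_finMulAntidiag hd i)
  choose v hvw hdv using h
  refine ⟨v, hdv, hvw, ?_⟩
  have hprod := Nat.prod_eq_of_mem_finMulAntidiag hd
  simp_rw [hdv, Finset.prod_pow_eq_pow_sum] at hprod
  exact Nat.pow_right_injective hp.two_le hprod

/-- There are at most `(w+1)^k` tuples with product `p^w`. [folklore] -/
theorem card_prodTuples_prime_pow_le {p : ℕ} (hp : p.Prime) (w : ℕ) :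
    #(prodTuples k (p ^ w)) ≤ (w + 1) ^ k := by
  refine (Finset.card_filter_le _ _).trans ?_
  rw [Fintype.card_piFinset, Finset.prod_const, Finset.card_univ, Fintype.card_fin,
    Nat.divisors_prime_pow hp, Finset.card_map, Finset.card_range]

/-- **Tuples with prime product**: `Σ_{∏ dᵢ = p} F(d) = Σᵢ F(p eᵢ)` (the `k` single-slot tuples). [folklore] -/
theorem sum_prodTuples_prime {M : Type*} [AddCommMonoid M] {p : ℕ} (hp : p.Prime)
    (F : (Fin k → ℕ) → M) : ∑ d ∈ prodTuples k p, F d = ∑ i : Fin k, F (Pi.mulSingle i p) := by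
  classical
  rw [prodTuples_eq_finMulAntidiag]
  -- every tuple with product `p` is some `p eᵢ`
  have hstruct : ∀ d ∈ Nat.finMulAntidiag k p, ∃ i, d = Pi.mulSingle i p := by
    intro d hd
    obtain ⟨i, hi, huniq⟩ := Nat.finMulAntidiag_existsUnique_prime_dvd hp.squarefree
      (Nat.mem_primeFactorsList hp.ne_zero |>.mpr ⟨hp, dvd_refl p⟩) d hd
    refine ⟨i, funext fun j => ?_⟩
    have hdj : d j ∣ p := Nat.dvd_of_mem_finMulAntidiag hd j
    by_cases hij : j = i
    · subst hij
      rw [Pi.mulSingle_eq_same]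
      exact Nat.dvd_antisymm hdj hi
    · rw [Pi.mulSingle_eq_of_ne hij]
      rcases (Nat.dvd_prime hp).mp hdj with h1 | h1
      · exact h1
      · exact absurd (huniq j (h1 ▸ dvd_refl _)) hij
  have hmem : ∀ i : Fin k, Pi.mulSingle i p ∈ Nat.finMulAntidiag k p := by
    intro i
    rw [Nat.mem_finMulAntidiag]
    refine ⟨?_, hp.ne_zero⟩
    rw [Finset.prod_eq_single i (fun j _ hj => Pi.mulSingle_eq_of_ne hj _) (fun h => absurd
      (Finset.mem_univ i) h), Pi.mulSingle_eq_same]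
  have hinj : Function.Injective (fun i : Fin k => (Pi.mulSingle i p : Fin k → ℕ)) := by
    intro i j hij
    by_contra h
    have h1 : (Pi.mulSingle i p : Fin k → ℕ) i = (Pi.mulSingle j p : Fin k → ℕ) i := congr_fun hij i
    rw [Pi.mulSingle_eq_same, Pi.mulSingle_eq_of_ne h] at h1
    exact hp.one_lt.ne' h1
  have himage : Nat.finMulAntidiag k p = Finset.univ.image (fun i : Fin k => Pi.mulSingle i p) := by
    ext d
    rw [Finset.mem_image]
    constructor
    · intro hd
      obtain ⟨i, rfl⟩ := hstruct d hd
      exact ⟨i, Finset.mem_univ i, rfl⟩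
    · rintro ⟨i, -, rfl⟩
      exact hmem i
  rw [himage, Finset.sum_image fun i _ j _ h => hinj h]

/-- `lcm (p eᵢ) = p` and `c_f(p eᵢ) = ρᵢ(p) = #{n < p : p ∣ fᵢ(n)}`. [folklore] -/
theorem tupleLcm_tupleCount_mulSingle (f : Fin k → ℤ[X]) (p : ℕ) (i : Fin k) :
    tupleLcm (Pi.mulSingle i p : Fin k → ℕ) = p ∧
      tupleCount f (Pi.mulSingle i p) = polyRootCountMod ![f i] p := by
  have hL : tupleLcm (Pi.mulSingle i p : Fin k → ℕ) = p := by
    refine Nat.dvd_antisymm (Finset.lcm_dvd fun j _ => ?_) ?_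
    · by_cases hj : j = i
      · subst hj
        rw [Pi.mulSingle_eq_same]
      · rw [Pi.mulSingle_eq_of_ne hj]
        exact one_dvd _
    · have := Finset.dvd_lcm (s := Finset.univ) (f := (Pi.mulSingle i p : Fin k → ℕ)) (Finset.mem_univ i)
      rwa [Pi.mulSingle_eq_same] at this
  refine ⟨hL, ?_⟩
  rw [tupleCount, hL, polyRootCountMod_single]
  congr 1
  refine Finset.filter_congr fun n _ => ⟨fun h => by simpa using h i, fun h j => ?_⟩
  by_cases hj : j = i
  · subst hj
    simpa using h
  · rw [Pi.mulSingle_eq_of_ne hj]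
    simp

/-- `δ_f(p eᵢ) = ρᵢ(p)/p`. [folklore] -/
theorem tupleDens_mulSingle (f : Fin k → ℤ[X]) (p : ℕ) (i : Fin k) :
    tupleDens f (Pi.mulSingle i p) = (polyRootCountMod ![f i] p : ℝ) / p := by
  rw [tupleDens, (tupleLcm_tupleCount_mulSingle f p i).1, (tupleLcm_tupleCount_mulSingle f p i).2]

/-! ### Values at primes and vanishing at high prime powers -/

/-- `b(p) = (y − 1) Σᵢ ρᵢ(p)/p` at EVERY prime `p`, for every family and every real `y`. [folklore] -/
theorem bCoeff_prime (f : Fin k → ℤ[X]) (y : ℝ) {p : ℕ} (hp : p.Prime) :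
    bCoeff f y p = (y - 1) * ∑ i, (polyRootCountMod ![f i] p : ℝ) / p := by
  rw [bCoeff, sum_prodTuples_prime hp, Finset.mul_sum]
  refine Finset.sum_congr rfl fun i _ => ?_
  rw [tupleDens_mulSingle f p i,
    Finset.prod_eq_single i (fun j _ hj => by rw [Pi.mulSingle_eq_of_ne hj, thinWeight_one])
      (fun h => absurd (Finset.mem_univ i) h), Pi.mulSingle_eq_same, thinWeight_prime y hp]

/-- `b(p^ν) = 0` for `ν > 2k` (a tuple `(p^{vᵢ})` with `Σ vᵢ > 2k` has a slot `vᵢ ≥ 3`, and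
`h_y(p^v) = 0` for `v ≥ 3`). [folklore] -/
theorem bCoeff_prime_pow_eq_zero (f : Fin k → ℤ[X]) (y : ℝ) {p : ℕ} (hp : p.Prime) {ν : ℕ}
    (hν : 2 * k < ν) : bCoeff f y (p ^ ν) = 0 := by
  refine Finset.sum_eq_zero fun d hd => ?_
  obtain ⟨v, hdv, -, hsum⟩ := exists_pow_eq_of_mem_prodTuples hp hd
  have h3 : ∃ i, 3 ≤ v i := by
    by_contra h
    push Not at h
    have : ∑ i, v i ≤ ∑ _i : Fin k, 2 := Finset.sum_le_sum fun i _ => Nat.lt_succ_iff.1 (h i)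
    rw [Finset.sum_const, Finset.card_univ, Fintype.card_fin, smul_eq_mul] at this
    omega
  obtain ⟨i, hi⟩ := h3
  rw [Finset.prod_eq_zero (Finset.mem_univ i)
    (by rw [hdv i, thinWeight_prime_pow y hp, thinCoeff_of_three_le y hi]), zero_mul]

/-! ### The registered helper -/

/-- **typeILocal_mult** (registered helper sub-goal of `stub_typeILocal`, line `beta-thinned-root-kernel`):
the Type-I coefficient `b_{f,y} = bCoeff f y` is multiplicative on coprime arguments, for every family `f`
and every real `y` (pointwise products of tuples with coprime supports, `h_y` multiplicative, tuple
densities multiplicative by the Chinese remainder theorem). [folklore] -/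
theorem typeILocal_mult : ∀ (k : ℕ) (f : Fin k → ℤ[X]) (y : ℝ) (m n : ℕ), m.Coprime n →
    bCoeff f y (m * n) = bCoeff f y m * bCoeff f y n :=
  fun _ f y _ _ h => bCoeff_mul_of_coprime f y h

end

end Summit.Parity.BatemanHorn.Cruxes.SystemLSDRealSegment.BetaThinnedRootKernel
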